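import Summits.CriticalPhenomena.CardyFormulaZ2.Theorems.CardyComplexConeEdgePrecompactUFRSStrandsArms

/-!
# Three strands of one completion ⇒ half-plane arms, I: sectors relative to an exterior set
(line `qkz-strip-boundary-arm` of crux `CardyComplexCone.EdgePrecompact`, stmt-CriticalPhenomena-11387;
first file of the registered sub-goal `ufrs_rect_strandsHpArms_pure` — the deterministic half
"HT-A, pure case" of the flat three-strand decay: three corner-disjoint strands of ONE completed
configuration near a flat side of a rectangle give three GENUINE loose half-plane arms of `ω`)

This file is the exterior-set variant of the sector argument of `strands_arms_one`
(`…UFRSStrandsArms.lean`, Aizenman–Burchard sectors). Mesh `1`, any configuration `β`, `k`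
corner-disjoint orbit stretches across `A(z; r, R)`. NEW INPUT: a preconnected set `Z` inside the
open annulus `U = (r + 1/2, R - 1/2)` missing every perturbed piece of the stretches (in the
application: the part of `U` outside the lattice box of the domain, shrunk by `1/8`). OUTPUT
(`strands_sectorsZ`, registered anchor `ufrs_strandsSectorsZ`): the left / right sectors `cL a`,
`cR a` of the strands (components of `U` minus the pieces), the left walks (open edges, vertices in
`cL a`) and right walks (closed crossed edges, face centres in `cR a`) of the chains, the fibre
bound (no sector belongs to three strands, `PlaneTopology.not_three_arcs_touch`), and the two facts
about `Z`: (i) `Z` meets at most one left sector and at most one right sector (it lies in one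
component); (ii) a crossing segment of a corner with closed target edge, started at a face of a
right walk and kept inside `U`, stays in that right sector (closed dual steps miss the pieces,
`crossSeg_not_mem_piece`). For `k = 3` this selects (`strands_three_selectZ`) a strand whose left
sector misses `Z` and two strands with distinct right sectors, and dually — the raw material of the
WIRED and FREE cases of HT-A.

References: M. Aizenman, A. Burchard, Duke Math. J. 99 (1999), Appendix A, Lemma A.5 (sectors);
S. Smirnov, C. R. Acad. Sci. Paris 333 (2001), §2; G. F. Lawler, O. Schramm, W. Werner, Electron.
J. Probab. 7 (2002), Appendix A (half-plane arm events).
-/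

namespace Summit.CriticalPhenomena.CardyFormulaZ2.Cruxes.EdgePrecompact.QkzStripBoundaryArm

open MeasureTheory Filter Set Metric Complex
open scoped Topology BigOperators Pointwise
open Literature.Probability.LatticeModels Literature.Probability.Percolation
open Literature.Probability.RandomPlanarGeometry (DobrushinDomain)
open Summit.CriticalPhenomena.CardyFormulaZ2.Theses.CardyComplexCone
open Literature.Topology.PlaneTopology

noncomputable section

/-! ## Sectors relative to an exterior set -/

/-- **Sectors of corner-disjoint strands relative to an exterior set** (mesh `1`). For `k` orbit
stretches of `nextCorner β`, pairwise sharing no corner, each joining the `r`-ball of `z` to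
distance `≥ R ≥ r + 16`, and a preconnected set `Z` inside the open annulus `(r + 1/2, R - 1/2)`
missing every dart piece and every connector of the stretches: left sectors `cL`, right sectors
`cR` (pairwise equal or disjoint, no three strands with the same sector, at most one of each kind
meeting `Z`), left walks (support vertices in `cL`, open target edges) and right walks (support
face centres in `cR`, closed crossed target edges) of sub-chains of the stretches at distance in
`(r + 1, R - 1)`, with one end within `r + 4` and the other beyond `R - 4`; and crossing segments
from right-walk faces across closed edges stay in the right sector while they stay in the annulus. -/
theorem strands_sectorsZ (β : BondConfig (Site 2)) (z : ℂ) {k : ℕ} (c : Fin k → Site 2 × Fin 4)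
    (i j : Fin k → ℕ) {r R : ℝ} (hr : 0 ≤ r) (hrR : r + 16 ≤ R) (hij : ∀ a, i a ≤ j a)
    (hdir : ∀ a, (dist (Site.toComplex (cornerOrbit β (c a) (i a)).1) z ≤ r ∧
        R ≤ dist (Site.toComplex (cornerOrbit β (c a) (j a)).1) z) ∨
      (R ≤ dist (Site.toComplex (cornerOrbit β (c a) (i a)).1) z ∧
        dist (Site.toComplex (cornerOrbit β (c a) (j a)).1) z ≤ r))
    (hdis : ∀ a b, a ≠ b → ∀ s t, i a ≤ s → s ≤ j a → i b ≤ t → t ≤ j b →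
      cornerOrbit β (c a) s ≠ cornerOrbit β (c b) t)
    (Z : Set ℂ) (hZU : ∀ w ∈ Z, r + 1 / 2 < dist w z ∧ dist w z < R - 1 / 2) (hZc : IsPreconnected Z)
    (hZK : ∀ a t, i a ≤ t → t ≤ j a →
      (∀ w ∈ segment ℝ (sPt (cornerOrbit β (c a) t)) (tPt (cornerOrbit β (c a) t)), w ∉ Z) ∧
      (t < j a → ∀ w ∈ segment ℝ (tPt (cornerOrbit β (c a) t)) (sPt (cornerOrbit β (c a) (t + 1))), w ∉ Z)) :
    ∃ (cL cR : Fin k → Set ℂ) (xl yl xr yr : Fin k → Site 2) (WL : ∀ s, (zdGraph 2).Walk (xl s) (yl s))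
      (WR : ∀ s, (zdGraph 2).Walk (xr s) (yr s)),
      (∀ s₁ s₂ (P : ℂ), P ∈ cL s₁ → P ∈ cL s₂ → cL s₁ = cL s₂) ∧
      (∀ s₁ s₂ (P : ℂ), P ∈ cR s₁ → P ∈ cR s₂ → cR s₁ = cR s₂) ∧
      (∀ a₁ a₂ a₃ : Fin k, a₁ ≠ a₂ → a₂ ≠ a₃ → a₃ ≠ a₁ → cL a₁ = cL a₂ → cL a₂ = cL a₃ → False) ∧
      (∀ a₁ a₂ a₃ : Fin k, a₁ ≠ a₂ → a₂ ≠ a₃ → a₃ ≠ a₁ → cR a₁ = cR a₂ → cR a₂ = cR a₃ → False) ∧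
      (∀ s₁ s₂, (cL s₁ ∩ Z).Nonempty → (cL s₂ ∩ Z).Nonempty → cL s₁ = cL s₂) ∧
      (∀ s₁ s₂, (cR s₁ ∩ Z).Nonempty → (cR s₂ ∩ Z).Nonempty → cR s₁ = cR s₂) ∧
      (∀ s, ∀ w ∈ cL s ∪ cR s, r + 1 / 2 < dist w z ∧ dist w z < R - 1 / 2) ∧
      (∀ s, ∀ u ∈ (WL s).support, Site.toComplex u ∈ cL s ∧ ∃ t, i s ≤ t ∧ t ≤ j s ∧ u = (cornerOrbit β (c s) t).1 ∧
        r + 1 < dist (Site.toComplex u) z ∧ dist (Site.toComplex u) z < R - 1) ∧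
      (∀ s, ∀ e ∈ (WL s).edges, ∃ t, i s ≤ t ∧ t < j s ∧ e = cTgt (cornerOrbit β (c s) t) ∧ cTgt (cornerOrbit β (c s) t) ∈ β ∧
        r + 1 < dist (Site.toComplex (cornerOrbit β (c s) t).1) z ∧ dist (Site.toComplex (cornerOrbit β (c s) t).1) z < R - 1) ∧
      (∀ s, (dist (Site.toComplex (xl s)) z ≤ r + 4 ∧ R - 4 ≤ dist (Site.toComplex (yl s)) z) ∨
        (dist (Site.toComplex (yl s)) z ≤ r + 4 ∧ R - 4 ≤ dist (Site.toComplex (xl s)) z)) ∧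
      (∀ s, ∀ g ∈ (WR s).support, faceCenter g ∈ cR s ∧ ∃ t, i s ≤ t ∧ t ≤ j s ∧ g = cFace (cornerOrbit β (c s) t) ∧
        r + 1 < dist (faceCenter g) z ∧ dist (faceCenter g) z < R - 1) ∧
      (∀ s, ∀ d ∈ (WR s).darts, ∃ t, i s ≤ t ∧ t < j s ∧ sepEdge d.fst d.snd = cTgt (cornerOrbit β (c s) t) ∧
        cTgt (cornerOrbit β (c s) t) ∉ β ∧
        r + 1 < dist (Site.toComplex (cornerOrbit β (c s) t).1) z ∧ dist (Site.toComplex (cornerOrbit β (c s) t).1) z < R - 1) ∧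
      (∀ s, (dist (Site.toComplex (xr s)) z ≤ r + 4 ∧ R - 4 ≤ dist (Site.toComplex (yr s)) z) ∨
        (dist (Site.toComplex (yr s)) z ≤ r + 4 ∧ R - 4 ≤ dist (Site.toComplex (xr s)) z)) ∧
      (∀ s, ∀ g ∈ (WR s).support, ∀ p : Site 2 × Fin 4, cFace p = g → cTgt p ∉ β →
        ∀ P ∈ segment ℝ (faceCenter (cFace p)) (faceCenter (faceAt p.1 (p.2 + 1))),
          (∀ w ∈ segment ℝ (faceCenter g) P, r + 1 / 2 < dist w z ∧ dist w z < R - 1 / 2) → P ∈ cR s) := by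
  classical
  /- the stretches re-based at their first corner: `O (q a) t = O (c a) (i a + t)`, `t ≤ n a` -/
  set q : Fin k → Site 2 × Fin 4 := fun a => cornerOrbit β (c a) (i a) with hq
  set n : Fin k → ℕ := fun a => j a - i a with hn
  have horb : ∀ a t, cornerOrbit β (q a) t = cornerOrbit β (c a) (i a + t) := fun a t =>
    (cornerOrbit_add_eq β (c a) (i a) t).symm
  have hdir' : ∀ a, (dist (Site.toComplex (cornerOrbit β (q a) 0).1) z ≤ r ∧
        R ≤ dist (Site.toComplex (cornerOrbit β (q a) (n a)).1) z) ∨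
      (R ≤ dist (Site.toComplex (cornerOrbit β (q a) 0).1) z ∧
        dist (Site.toComplex (cornerOrbit β (q a) (n a)).1) z ≤ r) := by
    intro a
    rw [horb, horb, add_zero, show i a + n a = j a from Nat.add_sub_cancel' (hij a)]
    exact hdir a
  /- per-strand data: tight arc, middle dart, chain -/
  choose E F T m i' j' hEd hFd htight hTsub hmT hmstrict hi'm hmj' hj'n hchain hends using
    fun a => strand_tightArc β (q a) (n a) z hrR (hdir' a)
  /- the obstacle: all pieces of all stretches -/
  set K : Set ℂ := ⋃ a, ⋃ jj ∈ Finset.range (2 * n a + 1),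
    segment ℝ (pieceVert β (q a) jj) (pieceVert β (q a) (jj + 1)) with hK
  have hKc : IsClosed K := by
    refine isClosed_iUnion_of_finite fun a => isClosed_biUnion_finset fun jj _ => ?_
    rw [← Path.range_segment]
    exact (isCompact_range (Path.segment _ _).continuous).isClosed
  have hmemK : ∀ {w : ℂ}, w ∈ K ↔ ∃ a jj, jj ≤ 2 * n a ∧ w ∈ segment ℝ (pieceVert β (q a) jj) (pieceVert β (q a) (jj + 1)) := by
    intro w
    simp only [hK, mem_iUnion, Finset.mem_range, exists_prop]
    constructor
    · rintro ⟨a, jj, hjj, hw⟩; exact ⟨a, jj, by omega, hw⟩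
    · rintro ⟨a, jj, hjj, hw⟩; exact ⟨a, jj, by omega, hw⟩
  have hpieceK : ∀ a jj, jj ≤ 2 * n a → segment ℝ (pieceVert β (q a) jj) (pieceVert β (q a) (jj + 1)) ⊆ K :=
    fun a jj hjj w hw => hmemK.2 ⟨a, jj, hjj, hw⟩
  have hTK : ∀ a, range (T a) ⊆ K := by
    intro a w hw
    obtain ⟨jj, hjj, hw⟩ := mem_iUnion₂.1 (hTsub a hw)
    exact hpieceK a jj (by have := Finset.mem_range.1 hjj; omega) hw
  have hvert : ∀ u : Site 2, Site.toComplex u ∉ K := fun u hu => by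
    obtain ⟨a, jj, -, hw⟩ := hmemK.1 hu
    exact toComplex_not_mem_piece β (q a) u jj hw
  have hcent : ∀ g : Site 2, faceCenter g ∉ K := fun g hg => by
    obtain ⟨a, jj, -, hw⟩ := hmemK.1 hg
    exact faceCenter_not_mem_piece β (q a) g jj hw
  have hKe : ∀ u w : Site 2, (zdGraph 2).Adj u w → s(u, w) ∈ β →
      ∀ P ∈ segment ℝ (Site.toComplex u) (Site.toComplex w), P ∉ K := fun u w hadj huw P hP hPK => by
    obtain ⟨b, jj, -, hPb⟩ := hmemK.1 hPK
    exact openEdge_not_mem_piece (q b) hadj huw hPb hP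
  have hKx : ∀ p : Site 2 × Fin 4, cTgt p ∉ β →
      ∀ P ∈ segment ℝ (faceCenter (cFace p)) (faceCenter (faceAt p.1 (p.2 + 1))), P ∉ K := fun p hp P hP hPK => by
    obtain ⟨b, jj, -, hPb⟩ := hmemK.1 hPK
    exact crossSeg_not_mem_piece (q b) hp hPb hP
  /- the exterior set misses the obstacle -/
  have hZK' : ∀ w ∈ Z, w ∉ K := by
    intro w hwZ hwK
    obtain ⟨a, jj, hjj, hw⟩ := hmemK.1 hwK
    obtain ⟨t', rfl | rfl⟩ := Nat.even_or_odd' jj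
    · rw [pieceVert_even, pieceVert_odd, horb] at hw
      have hia := hij a
      exact (hZK a (i a + t') (Nat.le_add_right _ _) (by simp only [hn] at hjj; omega)).1 w hw hwZ
    · rw [show 2 * t' + 1 + 1 = 2 * t' + 2 by ring, pieceVert_odd, pieceVert_odd_succ] at hw
      have h2 : sPt (nextCorner β (cornerOrbit β (q a) t')) = sPt (cornerOrbit β (c a) (i a + t' + 1)) := by
        rw [show i a + t' + 1 = i a + (t' + 1) by ring, ← horb]; rfl
      rw [h2, horb] at hw
      have hia := hij a
      exact (hZK a (i a + t') (Nat.le_add_right _ _) (by simp only [hn] at hjj; omega)).2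
        (by simp only [hn] at hjj; omega) w hw hwZ
  /- pieces of different stretches are disjoint -/
  have hdisj : ∀ a b, a ≠ b → Disjoint (range (T a)) (range (T b)) := by
    intro a b hab
    refine Set.disjoint_left.2 fun w hw hw' => ?_
    obtain ⟨jj, hjj, hw⟩ := mem_iUnion₂.1 (hTsub a hw)
    obtain ⟨jj', hjj', hw'⟩ := mem_iUnion₂.1 (hTsub b hw')
    have hjj₁ := Finset.mem_range.1 hjj
    have hjj₂ := Finset.mem_range.1 hjj'
    obtain ⟨s, t, hs, ht, hst⟩ := pieces_meet (q a) (q b) hw hw'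
    rw [horb, horb] at hst
    have hi := hij a; have hi' := hij b
    exact hdis a b hab (i a + s) (i b + t) (Nat.le_add_right _ _) (by simp only [hn] at hjj₁; omega)
      (Nat.le_add_right _ _) (by simp only [hn] at hjj₂; omega) hst
  /- the open annulus, the region, the sectors -/
  set U : Set ℂ := {w | r + 1 / 2 < dist w z ∧ dist w z < R - 1 / 2} with hU
  set X : Set ℂ := U \ K with hX
  set cL : Fin k → Set ℂ := fun a => connectedComponentIn X (Site.toComplex (cornerOrbit β (q a) (m a)).1) with hcL
  set cR : Fin k → Set ℂ := fun a => connectedComponentIn X (faceCenter (cFace (cornerOrbit β (q a) (m a)))) with hcR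
  have hcc : ∀ a t, i' a ≤ t → t ≤ j' a →
      Site.toComplex (cornerOrbit β (q a) t).1 ∈ cL a ∧ faceCenter (cFace (cornerOrbit β (q a) t)) ∈ cR a :=
    fun a t h1 h2 => chain_in_component β (q a) z K hvert hcent hKe hKx (hchain a) (hi'm a) (hmj' a) h1 h2
  /- the arcs touch the closures of both sectors of their middle dart -/
  have hprobe : ∀ a, segment ℝ (Site.toComplex (cornerOrbit β (q a) (m a)).1) (faceCenter (cFace (cornerOrbit β (q a) (m a)))) ⊆ U ∧
      (segment ℝ (Site.toComplex (cornerOrbit β (q a) (m a)).1) (faceCenter (cFace (cornerOrbit β (q a) (m a)))) ∩ K).Nonempty ∧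
      segment ℝ (Site.toComplex (cornerOrbit β (q a) (m a)).1) (faceCenter (cFace (cornerOrbit β (q a) (m a)))) ∩ K ⊆
        segment ℝ (sPt (cornerOrbit β (q a) (m a))) (tPt (cornerOrbit β (q a) (m a))) := by
    intro a
    have hc := hchain a (m a) (hi'm a) (hmj' a)
    refine ⟨fun P hP => ?_, ?_, ?_⟩
    · obtain ⟨h1, h2⟩ := segment_annulus ⟨hc.1, hc.2.1⟩ ⟨hc.2.2.1, hc.2.2.2⟩
        (by rw [dist_comm]; exact (dist_faceCenter_vertex_lt _).le.trans (by norm_num)) P hP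
      exact ⟨by linarith, by linarith⟩
    · obtain ⟨P, hP, hPo⟩ := exists_mem_dartSeg_mem_openSegment (isCorner_cFace (cornerOrbit β (q a) (m a)))
      refine ⟨P, openSegment_subset_segment ℝ _ _ hPo, hpieceK a (2 * m a) (by have := hmj' a; have := hj'n a; omega) ?_⟩
      rw [piece_even_eq_cyDart, cyDart_eq]; exact hP
    · rintro w ⟨hw, hwK⟩
      obtain ⟨b, jj, -, hwb⟩ := hmemK.1 hwK
      obtain ⟨s, rfl, hs⟩ := eq_of_mem_piece_halfDiag β (q b) (v := (cornerOrbit β (q a) (m a)).1)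
        (k := (cornerOrbit β (q a) (m a)).2) hwb hw
      rw [pieceVert_even, pieceVert_odd, hs] at hwb
      exact hwb
  have htouch : ∀ a, (closure (cL a) ∩ range (T a) ∩ U).Nonempty ∧ (closure (cR a) ∩ range (T a) ∩ U).Nonempty := by
    intro a
    obtain ⟨hpU, hpne, hpD⟩ := hprobe a
    constructor
    · obtain ⟨P, hPD, hPcl⟩ := exists_mem_closure_of_probe hKc (hvert _) hpU hpne hpD
      exact ⟨P, ⟨hPcl, hmT a hPD⟩, hmstrict a P hPD⟩
    · rw [segment_symm] at hpU hpne hpD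
      obtain ⟨P, hPD, hPcl⟩ := exists_mem_closure_of_probe hKc (hcent _) hpU hpne hpD
      exact ⟨P, ⟨hPcl, hmT a hPD⟩, hmstrict a P hPD⟩
  /- no sector is touched by three arcs -/
  have hthree : ∀ (S : Set ℂ), S ⊆ X → IsPreconnected S → ∀ a₁ a₂ a₃ : Fin k, a₁ ≠ a₂ → a₂ ≠ a₃ → a₃ ≠ a₁ →
      (closure S ∩ range (T a₁) ∩ U).Nonempty → (closure S ∩ range (T a₂) ∩ U).Nonempty →
      (closure S ∩ range (T a₃) ∩ U).Nonempty → False := by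
    intro S hSX hS a₁ a₂ a₃ h12 h23 h31 ht1 ht2 ht3
    exact not_three_arcs_touch (by linarith) (by linarith) T hEd hFd
      (fun l u => ⟨(htight l _ ⟨u, rfl⟩).1, (htight l _ ⟨u, rfl⟩).2.1⟩)
      (fun l u hu => (htight l _ ⟨u, rfl⟩).2.2.1 hu) (fun l u hu => (htight l _ ⟨u, rfl⟩).2.2.2 hu) hdisj hS
      (fun w hw => (hSX hw).1) (fun l => Set.disjoint_left.2 fun w hw hw' => (hSX hw).2 (hTK l hw')) h12 h23 h31
      ht1 ht2 ht3
  have hfibL : ∀ a₁ a₂ a₃ : Fin k, a₁ ≠ a₂ → a₂ ≠ a₃ → a₃ ≠ a₁ → cL a₁ = cL a₂ → cL a₂ = cL a₃ → False := by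
    intro a₁ a₂ a₃ h12 h23 h31 e12 e23
    refine hthree (cL a₁) (connectedComponentIn_subset _ _) isPreconnected_connectedComponentIn a₁ a₂ a₃ h12 h23 h31
      (htouch a₁).1 ?_ ?_
    · rw [e12]; exact (htouch a₂).1
    · rw [e12, e23]; exact (htouch a₃).1
  have hfibR : ∀ a₁ a₂ a₃ : Fin k, a₁ ≠ a₂ → a₂ ≠ a₃ → a₃ ≠ a₁ → cR a₁ = cR a₂ → cR a₂ = cR a₃ → False := by
    intro a₁ a₂ a₃ h12 h23 h31 e12 e23
    refine hthree (cR a₁) (connectedComponentIn_subset _ _) isPreconnected_connectedComponentIn a₁ a₂ a₃ h12 h23 h31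
      (htouch a₁).2 ?_ ?_
    · rw [e12]; exact (htouch a₂).2
    · rw [e12, e23]; exact (htouch a₃).2
  /- the exterior set lies in one component -/
  have hZX : Z ⊆ X := fun w hw => ⟨hZU w hw, hZK' w hw⟩
  have hZone : ∀ (C₁ C₂ : Set ℂ) (b₁ b₂ : ℂ), C₁ = connectedComponentIn X b₁ → C₂ = connectedComponentIn X b₂ →
      (C₁ ∩ Z).Nonempty → (C₂ ∩ Z).Nonempty → C₁ = C₂ := by
    rintro C₁ C₂ b₁ b₂ rfl rfl ⟨P₁, hP₁C, hP₁Z⟩ ⟨P₂, hP₂C, hP₂Z⟩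
    have hZsub : Z ⊆ connectedComponentIn X P₁ := hZc.subset_connectedComponentIn hP₁Z hZX
    rw [connectedComponentIn_eq hP₁C, connectedComponentIn_eq hP₂C]
    exact connectedComponentIn_eq (hZsub hP₂Z)
  /- the walks of the chains -/
  choose WL hWLs hWLe using fun s => exists_leftWalk β (q s) (i' s) (j' s) ((hi'm s).trans (hmj' s))
  choose WR hWRs hWRd using fun s => exists_rightWalk β (q s) (i' s) (j' s) ((hi'm s).trans (hmj' s))
  have hface1 : ∀ (g : Site 2) (d : ℝ), dist (faceCenter g) z < d → dist (Site.toComplex g) z ≤ d + 1 := by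
    intro g d h
    have hx := dist_toComplex_faceCenter_lt g
    linarith [dist_triangle (Site.toComplex g) (faceCenter g) z]
  have hface2 : ∀ (g : Site 2) (d : ℝ), d < dist (faceCenter g) z → d - 1 ≤ dist (Site.toComplex g) z := by
    intro g d h
    have hx := dist_toComplex_faceCenter_lt g
    linarith [dist_triangle (faceCenter g) (Site.toComplex g) z, dist_comm (faceCenter g) (Site.toComplex g)]
  have hrange : ∀ s t, i' s ≤ t → t ≤ j' s → i s ≤ i s + t ∧ i s + t ≤ j s := fun s t _ h2 =>
    ⟨Nat.le_add_right _ _, by have h3 := hj'n s; have h4 := hij s; simp only [hn] at h3; omega⟩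
  refine ⟨cL, cR, _, _, _, _, WL, WR,
    fun s₁ s₂ P h1 h2 => (connectedComponentIn_eq h1).trans (connectedComponentIn_eq h2).symm,
    fun s₁ s₂ P h1 h2 => (connectedComponentIn_eq h1).trans (connectedComponentIn_eq h2).symm,
    hfibL, hfibR, fun s₁ s₂ h1 h2 => hZone _ _ _ _ rfl rfl h1 h2, fun s₁ s₂ h1 h2 => hZone _ _ _ _ rfl rfl h1 h2,
    fun s w hw => ?_, fun s u hu => ?_, fun s e he => ?_, fun s => ?_, fun s g hg => ?_, fun s d hd => ?_, fun s => ?_,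
    fun s g hg p hpg hp P hP hPU => ?_⟩
  · rcases hw with hw | hw
    · exact (connectedComponentIn_subset _ _ hw).1
    · exact (connectedComponentIn_subset _ _ hw).1
  · obtain ⟨t, h1, h2, rfl⟩ := hWLs s u hu
    have hc := hchain s t h1 h2
    refine ⟨(hcc s t h1 h2).1, i s + t, (hrange s t h1 h2).1, (hrange s t h1 h2).2, by rw [horb], hc.1, hc.2.1⟩
  · obtain ⟨t, h1, h2, rfl, hopen⟩ := hWLe s e he
    have hc := hchain s t h1 h2.le
    refine ⟨i s + t, Nat.le_add_right _ _, ?_, by rw [horb], by rw [← horb]; exact hopen,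
      by rw [← horb]; exact hc.1, by rw [← horb]; exact hc.2.1⟩
    have h3 := hj'n s; have h4 := hij s; simp only [hn] at h3; omega
  · rcases hends s with ⟨h1, -, h3, -⟩ | ⟨h1, -, h3, -⟩
    · exact Or.inl ⟨by linarith, by linarith⟩
    · exact Or.inr ⟨by linarith, by linarith⟩
  · obtain ⟨t, h1, h2, rfl⟩ := hWRs s g hg
    have hc := hchain s t h1 h2
    refine ⟨(hcc s t h1 h2).2, i s + t, (hrange s t h1 h2).1, (hrange s t h1 h2).2, by rw [horb], hc.2.2.1, hc.2.2.2⟩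
  · obtain ⟨t, h1, h2, hsep, hclosed⟩ := hWRd s d hd
    have hc := hchain s t h1 h2.le
    refine ⟨i s + t, Nat.le_add_right _ _, ?_, by rw [hsep, horb], by rw [← horb]; exact hclosed,
      by rw [← horb]; exact hc.1, by rw [← horb]; exact hc.2.1⟩
    have h3 := hj'n s; have h4 := hij s; simp only [hn] at h3; omega
  · rcases hends s with ⟨-, h2, -, h4⟩ | ⟨-, h2, -, h4⟩
    · exact Or.inl ⟨by linarith [hface1 _ _ h2], by linarith [hface2 _ _ h4]⟩
    · exact Or.inr ⟨by linarith [hface1 _ _ h4], by linarith [hface2 _ _ h2]⟩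
  · -- the probe `[faceCenter g, P]` lies in `X`, hence in the right sector of `g`
    obtain ⟨t, h1, h2, rfl⟩ := hWRs s g hg
    have hgc : faceCenter (cFace (cornerOrbit β (q s) t)) ∈ cR s := (hcc s t h1 h2).2
    have hsub : segment ℝ (faceCenter (cFace (cornerOrbit β (q s) t))) P ⊆
        segment ℝ (faceCenter (cFace p)) (faceCenter (faceAt p.1 (p.2 + 1))) := by
      refine (convex_segment _ _).segment_subset ?_ hP
      rw [hpg]; exact left_mem_segment _ _ _
    have hPX : P ∈ connectedComponentIn X (faceCenter (cFace (cornerOrbit β (q s) t))) :=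
      (convex_segment _ _).isPreconnected.subset_connectedComponentIn (left_mem_segment _ _ _)
        (show segment ℝ _ P ⊆ X from fun w hw => ⟨hPU w hw, hKx p hp w (hsub hw)⟩) (right_mem_segment _ _ _)
    rwa [← connectedComponentIn_eq hgc] at hPX


/-! ## Selection for three strands -/

/-- **Pigeonhole for three strands.** If no value of `f` on `Fin 3` is taken three times and all
"bad" indices have the same value, then some index is good and two indices have different values. -/
theorem select_three_HTP {γ : Type*} (f : Fin 3 → γ) (bad : Fin 3 → Prop)
    (hfib : ∀ a₁ a₂ a₃ : Fin 3, a₁ ≠ a₂ → a₂ ≠ a₃ → a₃ ≠ a₁ → f a₁ = f a₂ → f a₂ = f a₃ → False)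
    (hbad : ∀ s₁ s₂, bad s₁ → bad s₂ → f s₁ = f s₂) :
    (∃ a, ¬ bad a) ∧ ∃ b₁ b₂, f b₁ ≠ f b₂ := by
  have h01 : (0 : Fin 3) ≠ 1 := by decide
  have h12 : (1 : Fin 3) ≠ 2 := by decide
  have h20 : (2 : Fin 3) ≠ 0 := by decide
  constructor
  · by_contra h
    push Not at h
    exact hfib 0 1 2 h01 h12 h20 (hbad 0 1 (h 0) (h 1)) (hbad 1 2 (h 1) (h 2))
  · by_contra h
    push Not at h
    exact hfib 0 1 2 h01 h12 h20 (h 0 1) (h 1 2)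

/-- **Sectors relative to an exterior set** (registered anchor `ufrs_strandsSectorsZ` of
stmt-CriticalPhenomena-11387; `strands_sectorsZ` with all binders explicit). -/
theorem ufrs_strandsSectorsZ : ∀ (β : BondConfig (Site 2)) (z : ℂ) (k : ℕ) (c : Fin k → Site 2 × Fin 4) (i j : Fin k → ℕ) (r R : ℝ), 0 ≤ r → r + 16 ≤ R → (∀ a, i a ≤ j a) → (∀ a, (dist (Site.toComplex (cornerOrbit β (c a) (i a)).1) z ≤ r ∧ R ≤ dist (Site.toComplex (cornerOrbit β (c a) (j a)).1) z) ∨ (R ≤ dist (Site.toComplex (cornerOrbit β (c a) (i a)).1) z ∧ dist (Site.toComplex (cornerOrbit β (c a) (j a)).1) z ≤ r)) → (∀ a b, a ≠ b → ∀ s t, i a ≤ s → s ≤ j a → i b ≤ t → t ≤ j b → cornerOrbit β (c a) s ≠ cornerOrbit β (c b) t) → ∀ (Z : Set ℂ), (∀ w ∈ Z, r + 1 / 2 < dist w z ∧ dist w z < R - 1 / 2) → IsPreconnected Z → (∀ a t, i a ≤ t → t ≤ j a → (∀ w ∈ segment ℝ (sPt (cornerOrbit β (c a) t)) (tPt (cornerOrbit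 β (c a) t)), w ∉ Z) ∧ (t < j a → ∀ w ∈ segment ℝ (tPt (cornerOrbit β (c a) t)) (sPt (cornerOrbit β (c a) (t + 1))), w ∉ Z)) → ∃ (cL cR : Fin k → Set ℂ) (xl yl xr yr : Fin k → Site 2) (WL : ∀ s, (zdGraph 2).Walk (xl s) (yl s)) (WR : ∀ s, (zdGraph 2).Walk (xr s) (yr s)), (∀ s₁ s₂ (P : ℂ), P ∈ cL s₁ → P ∈ cL s₂ → cL s₁ = cL s₂) ∧ (∀ s₁ s₂ (P : ℂ), P ∈ cR s₁ → P ∈ cR s₂ → cR s₁ = cR s₂) ∧ (∀ a₁ a₂ a₃ : Fin k, a₁ ≠ a₂ → a₂ ≠ a₃ → a₃ ≠ a₁ → cL a₁ = cL a₂ → cL a₂ = cL a₃ → False) ∧ (∀ a₁ a₂ a₃ : Fin k, a₁ ≠ a₂ → a₂ ≠ a₃ → a₃ ≠ a₁ → cR a₁ = cR a₂ → cR a₂ = cR a₃ → False) ∧ (∀ s₁ s₂, (cL s₁ ∩ Z).Nonempty → (cL s₂ ∩ Z).Nonempty → cL s₁ = cL s₂) ∧ (∀ s₁ s₂, (cR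 s₁ ∩ Z).Nonempty → (cR s₂ ∩ Z).Nonempty → cR s₁ = cR s₂) ∧ (∀ s, ∀ w ∈ cL s ∪ cR s, r + 1 / 2 < dist w z ∧ dist w z < R - 1 / 2) ∧ (∀ s, ∀ u ∈ (WL s).support, Site.toComplex u ∈ cL s ∧ ∃ t, i s ≤ t ∧ t ≤ j s ∧ u = (cornerOrbit β (c s) t).1 ∧ r + 1 < dist (Site.toComplex u) z ∧ dist (Site.toComplex u) z < R - 1) ∧ (∀ s, ∀ e ∈ (WL s).edges, ∃ t, i s ≤ t ∧ t < j s ∧ e = cTgt (cornerOrbit β (c s) t) ∧ cTgt (cornerOrbit β (c s) t) ∈ β ∧ r + 1 < dist (Site.toComplex (cornerOrbit β (c s) t).1) z ∧ dist (Site.toComplex (cornerOrbit β (c s) t).1) z < R - 1) ∧ (∀ s, (dist (Site.toComplex (xl s)) z ≤ r + 4 ∧ R - 4 ≤ dist (Site.toComplex (yl s)) z) ∨ (dist (Site.toComplex (yl s)) z ≤ r + 4 ∧ R - 4 ≤ dist (Site.toComplex (xl s)) z)) ∧ (∀ s, ∀ g ∈ (WR s).support, faceCenter g ∈ cR s ∧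 ∃ t, i s ≤ t ∧ t ≤ j s ∧ g = cFace (cornerOrbit β (c s) t) ∧ r + 1 < dist (faceCenter g) z ∧ dist (faceCenter g) z < R - 1) ∧ (∀ s, ∀ d ∈ (WR s).darts, ∃ t, i s ≤ t ∧ t < j s ∧ sepEdge d.fst d.snd = cTgt (cornerOrbit β (c s) t) ∧ cTgt (cornerOrbit β (c s) t) ∉ β ∧ r + 1 < dist (Site.toComplex (cornerOrbit β (c s) t).1) z ∧ dist (Site.toComplex (cornerOrbit β (c s) t).1) z < R - 1) ∧ (∀ s, (dist (Site.toComplex (xr s)) z ≤ r + 4 ∧ R - 4 ≤ dist (Site.toComplex (yr s)) z) ∨ (dist (Site.toComplex (yr s)) z ≤ r + 4 ∧ R - 4 ≤ dist (Site.toComplex (xr s)) z)) ∧ (∀ s, ∀ g ∈ (WR s).support, ∀ p : Site 2 × Fin 4, cFace p = g → cTgt p ∉ β → ∀ P ∈ segment ℝ (faceCenter (cFace p)) (faceCenter (faceAt p.1 (p.2 + 1))), (∀ w ∈ segment ℝ (faceCenter g) P, r + 1 / 2 < dist w z ∧ dist w z < R - 1 / 2) → P ∈ cR s) :=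
  fun β z _k c i j _r _R hr hrR hij hdir hdis Z hZU hZc hZK => strands_sectorsZ β z c i j hr hrR hij hdir hdis Z hZU hZc hZK

end

end Summit.CriticalPhenomena.CardyFormulaZ2.Cruxes.EdgePrecompact.QkzStripBoundaryArm
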